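import Literature.Probability.Process.MatrixRenewalConstant
import HarnessLib

/-!
# The renewal–reward theorem for critical matrix renewal pairs (Abelian form): an additive reward collected along the pieces has
# density `Σ_{c,d} L_{oc} R̄_{cd} L_{do} / L_{oo}` per unit length (Abelian AND pointwise) — the same for every pair of levels (module «MATRIX-RENEWAL-REWARD»)

Topic `Literature/Probability/Process` (renewal theory; continues «MATRIX-RENEWAL-CONSTANT» `MatrixRenewalConstant.lean` — for a `RenewalKernelPair` `K`
with `K.Critical L`: the two generating-function renewal equations `Critical.genD_eq_genM_add_sum` / `…'`, `Critical.summable_genM`, the rank-one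
structure `Critical.L_mul_L_eq` and the scale `Critical.sum_L_mean_L` (`L_{oo} = Σ_{c,d} L_{oc} μ_{cd} L_{do}`) — and `MatrixRenewalCoefficients.lean`
(`Critical`: Abelian limits `(1 − s)Σ_m D(m)s^m → L > 0`, finite first moment)).  Lane «pcv-sawmu» (CriticalPhenomena venture), a-p2 g23 — the
abstract form of «CONTACT-DENSITY» (`RandomPlanarGeometry/HexSAWStripBridgeContactDensity.lean`, reward = number of surface contacts of a strip bridge).
Sources of the TEMPLATE: W. Feller I (1968) XIII.11 (cumulative / reward processes attached to a renewal process); E. Çinlar, Adv. Appl. Probab. 1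
(1969) (Markov renewal theory; NOT held — locator carried); E. Seneta (1973) §6.1–§6.2.  The arrangement (a «reward pair» tied to the renewal pair
by the derived renewal equation, the sandwich `Ŝ = (1 + D̂)R̂(1 + D̂)`, and the level-free quotient through the rank-one `L`) is the lane's.

## What is proved (namespace `Literature.Probability.Process.RenewalKernelPair`; `K.Critical L` throughout §2–§4; `R̂(s) = Σ_j R(j)s^j`,
## `Ŝ(s) = Σ_m S(m)s^m`, `D̂`, `Î` likewise, `R̄ = Σ_j R(j)` — written out, no further definitions besides the structure)

* §1 ★ `RewardPair K` — data `R(j), S(m) ≥ 0` with `S(m) = R(m) + Σ_{i+j=m}(R(i)D(j) + M(i)S(j))`, `Σ_j R(j) < ∞`, `Σ_m S(m)s^m < ∞` on `[0,1)`;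
  `summable_genR`, `tendsto_genR` (`R̂(s) → R̄`).
* §2 ★★ `genS_eq` — `Ŝ = R̂ + R̂D̂ + ÎŜ` on `[0,1)`; ★★ `genS_eq_sandwich` — `Ŝ = (1 + D̂) R̂ (1 + D̂)`.
* §3 `tendsto_one_sub_mul_one_add_genD` (`(1 − s)(1 + D̂) → L`); ★★★ `tendsto_sq_mul_genS` — `(1 − s)²Ŝ(s)_{ab} → (L R̄ L)_{ab}`.
* §4 ★★★★ `tendsto_reward_per_length` — `(1 − s)Ŝ(s)_{ab}/D̂(s)_{ab} → (Σ_{c,d} L_{oc} R̄_{cd} L_{do})/L_{oo}` for every reference level `o` and ALL `a, b`: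
  the Abel-mean reward per unit length equals (mean reward of one piece)/(mean length of one piece) under the invariant weighting — level-free by rank one.
* §5 POINTWISE: `serS_eq` (`S = RG + IS` as power series), ★★ `serS_eq_sandwich` (`S = G R G` in `PowerSeries (Matrix ι ι ℝ)`, via `ren_right`), `S_eq_conv`,
  `tendsto_G_of_critical`, ★★★ `tendsto_S_div` — `S(m)_{ab}/(m+1) → (L R̄ L)_{ab}` («convergent ∗ summable» then a Cesàro product), ★★★★ `tendsto_S_div_D` —
  `S(m)_{ab}/((m+1) D(m)_{ab}) → (Σ_{c,d} L_{oc} R̄_{cd} L_{do})/L_{oo}`: THE POINTWISE RENEWAL–REWARD THEOREM (mean reward per unit length at FIXED total length `m`).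
* §6 PIECES: `cf_serG_mul_serM_mul_serG_nonneg`, ★★ `Critical.piecesRewardPair` (the reward pair with `R = I`, `S = G·I·G = Σ_k k I^k`: sequences counted with
  multiplicity = number of pieces), ★★★ `Critical.tendsto_pieces_div_D` — `N(m)_{ab}/((m+1) D(m)_{ab}) → (Σ_c L_{oc}L_{co})/L_{oo}` (`= ⟨ℓ,u⟩/⟨ℓ,μu⟩`): the
  ELEMENTARY RENEWAL THEOREM for the number of pieces per unit length (matrix form, pointwise).

Label: CLASSICAL THEOREM (renewal–reward / Markov renewal reward, Abelian form) in the lane's ARRANGEMENT (own proof route; a-p2 g23, 2026-08-27).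
NOT claimed: almost-sure / single-path versions, the periodic / null-recurrent cases (the hypothesis `Critical` is aperiodic and positive recurrent),
rewards of unbounded sign, anything beyond finite `ι`.
-/

noncomputable section

open Finset Filter Topology Matrix PowerSeries Literature.Analysis.Matrix

namespace Literature.Probability.Process

namespace RenewalKernelPair

variable {ι : Type*} [Fintype ι] [DecidableEq ι] {K : RenewalKernelPair ι} {L : ι → ι → ℝ}

/-- Cauchy product with powers for non-negative summable data (plumbing; Mathlib `Summable.tsum_mul_tsum_eq_tsum_sum_antidiagonal`).
[cite: Feller1968, XIII.3; lane plumbing] (Kept `private`: statement-twins are private elsewhere in the tree.) -/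
private theorem tsum_antidiagonal_mul_pow₄ {f g : ℕ → ℝ} (hf : ∀ m, 0 ≤ f m) (hg : ∀ m, 0 ≤ g m) {s : ℝ} (hs : 0 ≤ s)
    (hfs : Summable fun m => f m * s ^ m) (hgs : Summable fun m => g m * s ^ m) :
    (Summable fun m => (∑ p ∈ antidiagonal m, f p.1 * g p.2) * s ^ m) ∧
      ∑' m, (∑ p ∈ antidiagonal m, f p.1 * g p.2) * s ^ m = (∑' m, f m * s ^ m) * ∑' m, g m * s ^ m := by
  have hfg : Summable fun x : ℕ × ℕ => (fun m => f m * s ^ m) x.1 * (fun m => g m * s ^ m) x.2 :=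
    hfs.mul_of_nonneg hgs (fun m => mul_nonneg (hf m) (pow_nonneg hs m)) (fun m => mul_nonneg (hg m) (pow_nonneg hs m))
  have h1 := summable_sum_mul_antidiagonal_of_summable_mul (f := fun m => f m * s ^ m) (g := fun m => g m * s ^ m) hfg
  have h2 := hfs.tsum_mul_tsum_eq_tsum_sum_antidiagonal hgs hfg
  have hterm : ∀ m, ∑ p ∈ antidiagonal m, f p.1 * s ^ p.1 * (g p.2 * s ^ p.2) =
      (∑ p ∈ antidiagonal m, f p.1 * g p.2) * s ^ m := fun m => by
    rw [sum_mul]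
    refine sum_congr rfl fun p hp => ?_
    have hp' : p.1 + p.2 = m := HasAntidiagonal.mem_antidiagonal.mp hp
    rw [← hp', pow_add]; ring
  simp only [hterm] at h1 h2
  exact ⟨h1, h2.symm⟩

/-- `(1 − s) → 0` within `𝓝[<] 1` (plumbing). [folklore] -/
private theorem tendsto_one_sub_nhdsLT' : Tendsto (fun s : ℝ => 1 - s) (𝓝[<] 1) (𝓝 0) := by
  have : Tendsto (fun s : ℝ => 1 - s) (𝓝 1) (𝓝 (1 - 1)) := tendsto_const_nhds.sub tendsto_id
  rw [sub_self] at this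
  exact this.mono_left nhdsWithin_le_nhds

/-- ★ **A REWARD PAIR** over a matrix renewal pair: non-negative matrix sequences `R(j)` (the reward carried by ONE piece of length `j`,
summed over the pieces: e.g. `R(j)_{ab} = Σ_{pieces a→b of length j} reward × weight`) and `S(m)` (the total reward of all sequences of pieces of
total length `m`) tied by the DERIVED renewal equation `S(m) = R(m) + Σ_{i+j=m} (R(i) D(j) + M(i) S(j))` — the reward of a sequence is the reward of its
first piece plus the reward of the rest.  (For the honeycomb strip: reward = number of surface contacts, `RandomPlanarGeometry/HexSAWStripBridgeContactDensity`.)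
[cite: Feller1968, XIII.11 (cumulative processes / rewards); Cinlar1969MarkovRenewal, Markov renewal theory (locator carried — not held); lane «pcv-sawmu» a-p2 g23] -/
structure RewardPair (K : RenewalKernelPair ι) where
  /-- the one-piece reward kernel `R(j) ≥ 0` -/
  R : ℕ → Matrix ι ι ℝ
  /-- the total-reward kernel `S(m) ≥ 0` -/
  S : ℕ → Matrix ι ι ℝ
  /-- `R ≥ 0` -/
  R_nonneg : ∀ j a b, 0 ≤ R j a b
  /-- `S ≥ 0` -/
  S_nonneg : ∀ m a b, 0 ≤ S m a b
  /-- the derived renewal equation -/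
  ren : ∀ m, S m = R m + ∑ p ∈ antidiagonal m, (R p.1 * K.D p.2 + K.M p.1 * S p.2)
  /-- the one-piece reward is summable: `Σ_j R(j)_{ab} < ∞` (finite mean reward per piece) -/
  summable_R : ∀ a b, Summable fun j => R j a b
  /-- the total-reward generating function converges on `[0,1)` -/
  summable_S : ∀ (a b : ι) (s : ℝ), 0 ≤ s → s < 1 → Summable fun m => S m a b * s ^ m

namespace RewardPair

variable (W : RewardPair K)

/-- Summability of `Σ_j R(j) s^j` on `[0,1]` (plumbing). [cite: Feller1968, XIII.11; lane plumbing a-p2 g23] -/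
theorem summable_genR (a b : ι) {s : ℝ} (hs0 : 0 ≤ s) (hs1 : s ≤ 1) : Summable fun j : ℕ => W.R j a b * s ^ j :=
  (W.summable_R a b).of_nonneg_of_le (fun j => mul_nonneg (W.R_nonneg j a b) (pow_nonneg hs0 _))
    fun j => mul_le_of_le_one_right (W.R_nonneg j a b) (pow_le_one₀ hs0 hs1)

/-- `R̂(s) → R̄ := Σ_j R(j)` entrywise as `s ↑ 1` (dominated convergence). [cite: Feller1968, XIII.11; lane plumbing a-p2 g23] -/
theorem tendsto_genR (a b : ι) :
    Tendsto (fun s : ℝ => ∑' j : ℕ, W.R j a b * s ^ j) (𝓝[<] 1) (𝓝 (∑' j : ℕ, W.R j a b)) := by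
  have h0 := fun j => W.R_nonneg j a b
  exact tendsto_tsum_of_dominated_convergence (𝓕 := 𝓝[<] (1 : ℝ)) (f := fun (s : ℝ) (j : ℕ) => W.R j a b * s ^ j)
    (g := fun j => W.R j a b) (bound := fun j => W.R j a b) (W.summable_R a b)
    (fun j => by
      have : Tendsto (fun s : ℝ => W.R j a b * s ^ j) (𝓝 1) (𝓝 (W.R j a b * 1 ^ j)) := ((continuous_pow j).tendsto 1).const_mul _
      rw [one_pow, mul_one] at this
      exact this.mono_left nhdsWithin_le_nhds)
    (by
      filter_upwards [Ico_mem_nhdsLT zero_lt_one] with s hs j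
      rw [Real.norm_eq_abs, abs_of_nonneg (mul_nonneg (h0 j) (pow_nonneg hs.1 _))]
      exact mul_le_of_le_one_right (h0 j) (pow_le_one₀ hs.1 hs.2.le))

/-- ★★ **The derived renewal equation of the generating functions** (`0 ≤ s < 1`, under `K.Critical L`): `Ŝ(s) = R̂(s) + R̂(s)D̂(s) + Î(s)Ŝ(s)`
(as matrices of real generating functions; Cauchy products). [cite: Feller1968, XIII.11; Cinlar1969MarkovRenewal, Markov renewal equations (locator carried — not held); lane «pcv-sawmu» a-p2 g23] -/
theorem genS_eq (h : K.Critical L) {s : ℝ} (hs0 : 0 ≤ s) (hs1 : s < 1) :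
    (Matrix.of fun a b : ι => ∑' m : ℕ, W.S m a b * s ^ m) =
      (Matrix.of fun a b : ι => ∑' j : ℕ, W.R j a b * s ^ j) +
        (Matrix.of fun a b : ι => ∑' j : ℕ, W.R j a b * s ^ j) * (Matrix.of fun a b : ι => ∑' m : ℕ, K.D m a b * s ^ m) +
        (Matrix.of fun a b : ι => ∑' j : ℕ, K.M j a b * s ^ j) * (Matrix.of fun a b : ι => ∑' m : ℕ, W.S m a b * s ^ m) := by
  ext a b
  simp only [Matrix.add_apply, Matrix.mul_apply, Matrix.of_apply]
  have hc1 : ∀ c : ι,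
      (∑' j : ℕ, W.R j a c * s ^ j) * (∑' m : ℕ, K.D m c b * s ^ m) =
        ∑' m : ℕ, (∑ p ∈ antidiagonal m, W.R p.1 a c * K.D p.2 c b) * s ^ m ∧
      Summable (fun m : ℕ => (∑ p ∈ antidiagonal m, W.R p.1 a c * K.D p.2 c b) * s ^ m) := fun c => by
    obtain ⟨h1, h2⟩ := tsum_antidiagonal_mul_pow₄ (fun j => W.R_nonneg j a c) (fun m => K.D_nonneg m c b) hs0
      (W.summable_genR a c hs0 hs1.le) (h.summable c b s hs0 hs1)
    exact ⟨h2.symm, h1⟩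
  have hc2 : ∀ c : ι,
      (∑' j : ℕ, K.M j a c * s ^ j) * (∑' m : ℕ, W.S m c b * s ^ m) =
        ∑' m : ℕ, (∑ p ∈ antidiagonal m, K.M p.1 a c * W.S p.2 c b) * s ^ m ∧
      Summable (fun m : ℕ => (∑ p ∈ antidiagonal m, K.M p.1 a c * W.S p.2 c b) * s ^ m) := fun c => by
    obtain ⟨h1, h2⟩ := tsum_antidiagonal_mul_pow₄ (fun j => K.M_nonneg j a c) (fun m => W.S_nonneg m c b) hs0
      (h.summable_genM a c hs0 hs1.le) (W.summable_S c b s hs0 hs1)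
    exact ⟨h2.symm, h1⟩
  simp_rw [fun c => (hc1 c).1, fun c => (hc2 c).1]
  have hS := W.summable_S a b s hs0 hs1
  have hR := W.summable_genR a b hs0 hs1.le
  rw [← Summable.tsum_finsetSum (fun c _ => (hc1 c).2), ← Summable.tsum_finsetSum (fun c _ => (hc2 c).2),
    ← hR.tsum_add (summable_sum fun c _ => (hc1 c).2),
    ← (hR.add (summable_sum fun c _ => (hc1 c).2)).tsum_add (summable_sum fun c _ => (hc2 c).2)]
  refine tsum_congr fun m => ?_
  have hren := congr_fun (congr_fun (W.ren m) a) b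
  rw [Matrix.add_apply, Matrix.sum_apply] at hren
  simp only [Matrix.add_apply, Matrix.mul_apply] at hren
  rw [hren, add_mul, add_assoc]
  congr 1
  rw [← sum_mul, ← sum_mul, ← add_mul]
  congr 1
  simp only [← sum_add_distrib]
  rw [sum_comm]

/-- ★★ **The sandwich `Ŝ = (1 + D̂) R̂ (1 + D̂)`** on `[0,1)` (under `K.Critical L`): from `(1 − Î)Ŝ = R̂(1 + D̂)` and the two-sided inverse
`(1 + D̂)(1 − Î) = 1` (both GF renewal equations of «MATRIX-RENEWAL-CONSTANT»).  The derivative-of-the-resolvent structure of every additive reward.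
[cite: Seneta1973, §6.1 (resolvent series); Feller1968, XIII.11; lane «pcv-sawmu» a-p2 g23 — own] -/
theorem genS_eq_sandwich (h : K.Critical L) {s : ℝ} (hs0 : 0 ≤ s) (hs1 : s < 1) :
    (Matrix.of fun a b : ι => ∑' m : ℕ, W.S m a b * s ^ m) =
      (1 + Matrix.of fun a b : ι => ∑' m : ℕ, K.D m a b * s ^ m) *
        (Matrix.of fun a b : ι => ∑' j : ℕ, W.R j a b * s ^ j) *
        (1 + Matrix.of fun a b : ι => ∑' m : ℕ, K.D m a b * s ^ m) := by
  set Sg := (Matrix.of fun a b : ι => ∑' m : ℕ, W.S m a b * s ^ m) with hSg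
  set Rg := (Matrix.of fun a b : ι => ∑' j : ℕ, W.R j a b * s ^ j) with hRg
  set Dg := (Matrix.of fun a b : ι => ∑' m : ℕ, K.D m a b * s ^ m) with hDg
  set Ig := (Matrix.of fun a b : ι => ∑' j : ℕ, K.M j a b * s ^ j) with hIg
  have hren : Sg = Rg + Rg * Dg + Ig * Sg := W.genS_eq h hs0 hs1
  -- the right GF renewal equation `D̂ = Î + D̂ Î` gives `(1 + D̂)(1 − Î) = 1`
  have hright : Dg = Ig + Dg * Ig := by
    ext a b
    have := h.genD_eq_genM_add_sum' hs0 hs1 a b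
    simp only [hDg, hIg, Matrix.add_apply, Matrix.mul_apply, Matrix.of_apply]
    exact this
  have hinv : (1 + Dg) * (1 - Ig) = 1 := by
    rw [Matrix.add_mul, Matrix.one_mul, Matrix.mul_sub, Matrix.mul_one]
    conv_lhs => rw [show (1 : Matrix ι ι ℝ) - Ig + (Dg - Dg * Ig) = 1 + (Dg - (Ig + Dg * Ig)) by abel]
    rw [← hright, sub_self, add_zero]
  have h1 : (1 - Ig) * Sg = Rg * (1 + Dg) := by
    rw [Matrix.sub_mul, Matrix.one_mul, Matrix.mul_add, Matrix.mul_one, sub_eq_iff_eq_add]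
    exact hren
  calc Sg = ((1 + Dg) * (1 - Ig)) * Sg := by rw [hinv, Matrix.one_mul]
    _ = (1 + Dg) * ((1 - Ig) * Sg) := by rw [Matrix.mul_assoc]
    _ = (1 + Dg) * (Rg * (1 + Dg)) := by rw [h1]
    _ = (1 + Dg) * Rg * (1 + Dg) := by rw [Matrix.mul_assoc]

/-- `(1 − s)·(1 + D̂(s))_{ab} → L_{ab}` as `s ↑ 1` (the Abelian hypothesis; the `1` carries no mass). [cite: Feller1968, XIII.3; lane plumbing a-p2 g23] -/
theorem tendsto_one_sub_mul_one_add_genD (h : K.Critical L) (a b : ι) :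
    Tendsto (fun s : ℝ => (1 - s) * (1 + Matrix.of fun a b : ι => ∑' m : ℕ, K.D m a b * s ^ m) a b) (𝓝[<] 1) (𝓝 (L a b)) := by
  have h0 : Tendsto (fun s : ℝ => (1 - s) * (1 : Matrix ι ι ℝ) a b) (𝓝[<] 1) (𝓝 (0 * (1 : Matrix ι ι ℝ) a b)) :=
    tendsto_one_sub_nhdsLT'.mul_const _
  rw [zero_mul] at h0
  have := h0.add (h.abel a b)
  rw [zero_add] at this
  refine this.congr fun s => ?_
  rw [Matrix.add_apply, Matrix.of_apply, mul_add]

/-- ★★★ **THE SECOND-ORDER POLE OF THE TOTAL-REWARD SERIES**: under `K.Critical L`, for all `a, b`,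
`(1 − s)² Ŝ(s)_{ab} ⟶ (L · R̄ · L)_{ab} = Σ_{c,d} L_{ac} R̄_{cd} L_{db}` as `s ↑ 1`, `R̄ = Σ_j R(j)` (the sandwich, each bracket a simple pole).
[cite: Feller1968, XIII.11 (cumulative processes); Cinlar1969MarkovRenewal, Markov renewal theory (locator carried — not held); lane «pcv-sawmu» a-p2 g23 — own arrangement] -/
theorem tendsto_sq_mul_genS (h : K.Critical L) (a b : ι) :
    Tendsto (fun s : ℝ => (1 - s) ^ 2 * ∑' m : ℕ, W.S m a b * s ^ m) (𝓝[<] 1)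
      (𝓝 (∑ d, (∑ c, L a c * ∑' j : ℕ, W.R j c d) * L d b)) := by
  have hS := fun c d => tendsto_one_sub_mul_one_add_genD h c d
  have hR := fun c d => W.tendsto_genR c d
  have hlim : Tendsto (fun s : ℝ => ∑ d, (∑ c, ((1 - s) * (1 + Matrix.of fun a b : ι => ∑' m : ℕ, K.D m a b * s ^ m) a c) *
      (∑' j : ℕ, W.R j c d * s ^ j)) * ((1 - s) * (1 + Matrix.of fun a b : ι => ∑' m : ℕ, K.D m a b * s ^ m) d b)) (𝓝[<] 1)
      (𝓝 (∑ d, (∑ c, L a c * ∑' j : ℕ, W.R j c d) * L d b)) :=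
    tendsto_finsetSum _ fun d _ => (tendsto_finsetSum _ fun c _ => (hS a c).mul (hR c d)).mul (hS d b)
  refine hlim.congr' ?_
  filter_upwards [Ico_mem_nhdsLT zero_lt_one] with s hs
  have hsand := congr_fun (congr_fun (W.genS_eq_sandwich h hs.1 hs.2) a) b
  rw [Matrix.of_apply] at hsand
  rw [Matrix.mul_apply] at hsand
  simp only [Matrix.mul_apply, Matrix.of_apply] at hsand
  rw [hsand, Finset.mul_sum]
  refine sum_congr rfl fun d _ => ?_
  rw [Finset.sum_mul, Finset.sum_mul, Finset.mul_sum]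
  exact sum_congr rfl fun c _ => by ring

/-- ★★★★ **THE RENEWAL–REWARD THEOREM (Abelian form) FOR CRITICAL MATRIX RENEWAL PAIRS**: for every reference level `o` and ALL levels `a, b`,
`(1 − s) · Ŝ(s)_{ab} / D̂(s)_{ab} ⟶ θ := (Σ_{c,d} L_{oc} R̄_{cd} L_{do}) / L_{oo}` as `s ↑ 1`
— the Abel-mean reward per unit length is the SAME for every pair of levels and equals (mean reward of ONE piece)/(mean length of ONE piece) under
the invariant weighting `π(c → d) ∝ L_{oc} · (weight) · L_{do}` (recall `L_{oo} = Σ_{c,d} L_{oc} μ_{cd} L_{do}`, «MATRIX-RENEWAL-CONSTANT»).  Rank one of `L`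
(`L_{ac}L_{db}L_{oo} = L_{ao}…`) makes the quotient level-free. [cite: Feller1968, XIII.11 (renewal–reward); Cinlar1969MarkovRenewal, Markov renewal theory (locator carried — not held); Seneta1973, §6.2; lane «pcv-sawmu» a-p2 g23 — own arrangement] -/
theorem tendsto_reward_per_length (h : K.Critical L) (o a b : ι) :
    Tendsto (fun s : ℝ => (1 - s) * (∑' m : ℕ, W.S m a b * s ^ m) / ∑' m : ℕ, K.D m a b * s ^ m) (𝓝[<] 1)
      (𝓝 ((∑ d, (∑ c, L o c * ∑' j : ℕ, W.R j c d) * L d o) / L o o)) := by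
  have h2 := W.tendsto_sq_mul_genS h a b
  have h1 := h.abel a b
  have hq := h2.div h1 (h.pos a b).ne'
  -- the value: rank one of `L`
  have hval : (∑ d, (∑ c, L a c * ∑' j : ℕ, W.R j c d) * L d b) / L a b =
      (∑ d, (∑ c, L o c * ∑' j : ℕ, W.R j c d) * L d o) / L o o := by
    rw [div_eq_div_iff (h.pos a b).ne' (h.pos o o).ne', sum_mul, sum_mul]
    refine sum_congr rfl fun d _ => ?_
    rw [sum_mul, sum_mul, sum_mul, sum_mul]
    refine sum_congr rfl fun c _ => ?_
    -- `L_{ac} L_{db} L_{oo} = L_{oc} L_{do} L_{ab}`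
    have h3 : L a c * L d b * L o o = L o c * L d o * L a b := by
      have e1 := h.L_mul_L_eq a c o o   -- L a c * L o o = L a o * L o c
      have e2 := h.L_mul_L_eq d b a o   -- L d b * L a o = L d o * L a b
      calc L a c * L d b * L o o = (L a c * L o o) * L d b := by ring
        _ = L a o * L o c * L d b := by rw [e1]
        _ = L o c * (L d b * L a o) := by ring
        _ = L o c * (L d o * L a b) := by rw [e2]
        _ = L o c * L d o * L a b := by ring
    calc L a c * (∑' j : ℕ, W.R j c d) * L d b * L o o = (∑' j : ℕ, W.R j c d) * (L a c * L d b * L o o) := by ring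
      _ = (∑' j : ℕ, W.R j c d) * (L o c * L d o * L a b) := by rw [h3]
      _ = L o c * (∑' j : ℕ, W.R j c d) * L d o * L a b := by ring
  rw [← hval]
  refine hq.congr' ?_
  filter_upwards [self_mem_nhdsWithin] with s hs
  have hs1 : (1 : ℝ) - s ≠ 0 := sub_ne_zero.2 (ne_of_gt hs)
  rw [Pi.div_apply]
  field_simp

/-! ### §5 Pointwise: `S(m) = Σ_{i+j+k=m} G(i) R(j) G(k)` coefficientwise, and `S(m)_{ab}/m → (L R̄ L)_{ab}` -/

section Pointwise

variable (W : RewardPair K)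

/-- **Cesàro product lemma** (plumbing): if `a_n → A` and `b_n → B` then `(n+1)⁻¹ Σ_{i+j=n} a_i b_j → A B`. [folklore] -/
private theorem tendsto_antidiagonal_mul_div {a b : ℕ → ℝ} {A B : ℝ} (ha : Tendsto a atTop (𝓝 A)) (hb : Tendsto b atTop (𝓝 B)) :
    Tendsto (fun n : ℕ => (∑ p ∈ antidiagonal n, a p.1 * b p.2) / (n + 1)) atTop (𝓝 (A * B)) := by
  -- bounded `b`
  obtain ⟨Bb, hBb⟩ := hb.bddAbove_range
  obtain ⟨Bb', hBb'⟩ := hb.bddBelow_range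
  have hbabs : ∀ n, |b n| ≤ max |Bb| |Bb'| := fun n => by
    rw [abs_le]
    constructor
    · have := hBb' ⟨n, rfl⟩
      have h2 : -max |Bb| |Bb'| ≤ Bb' := by
        have := neg_abs_le Bb'; have := le_max_right |Bb| |Bb'|; linarith
      linarith
    · exact (hBb ⟨n, rfl⟩).trans ((le_abs_self Bb).trans (le_max_left _ _))
  set M := max |Bb| |Bb'| with hM
  have hM0 : 0 ≤ M := le_trans (abs_nonneg _) (le_max_left _ _)
  -- Cesàro means of `|a − A|` and `|b − B|` tend to `0`
  have hca : Tendsto (fun n : ℕ => ((n : ℝ)⁻¹) * ∑ i ∈ range n, |a i - A|) atTop (𝓝 0) := by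
    have h0 : Tendsto (fun i => |a i - A|) atTop (𝓝 0) := by
      have h1 : Tendsto (fun i => a i - A) atTop (𝓝 (A - A)) := ha.sub_const A
      rw [sub_self] at h1
      have h2 := h1.abs
      rwa [abs_zero] at h2
    exact h0.cesaro
  have hcb : Tendsto (fun n : ℕ => ((n : ℝ)⁻¹) * ∑ i ∈ range n, |b i - B|) atTop (𝓝 0) := by
    have h0 : Tendsto (fun i => |b i - B|) atTop (𝓝 0) := by
      have h1 : Tendsto (fun i => b i - B) atTop (𝓝 (B - B)) := hb.sub_const B
      rw [sub_self] at h1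
      have h2 := h1.abs
      rwa [abs_zero] at h2
    exact h0.cesaro
  -- shift the Cesàro means to `n + 1` terms
  have hca' : Tendsto (fun n : ℕ => (((n + 1 : ℕ) : ℝ)⁻¹) * ∑ i ∈ range (n + 1), |a i - A|) atTop (𝓝 0) :=
    hca.comp (tendsto_add_atTop_nat 1)
  have hcb' : Tendsto (fun n : ℕ => (((n + 1 : ℕ) : ℝ)⁻¹) * ∑ i ∈ range (n + 1), |b i - B|) atTop (𝓝 0) :=
    hcb.comp (tendsto_add_atTop_nat 1)
  -- the error bound
  have hbound : ∀ n : ℕ, |(∑ p ∈ antidiagonal n, a p.1 * b p.2) / (n + 1) - A * B| ≤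
      M * ((((n + 1 : ℕ) : ℝ)⁻¹) * ∑ i ∈ range (n + 1), |a i - A|) + |A| * ((((n + 1 : ℕ) : ℝ)⁻¹) * ∑ i ∈ range (n + 1), |b i - B|) := by
    intro n
    have hn : (0 : ℝ) < n + 1 := by positivity
    -- `Σ_{i+j=n} a_i b_j − (n+1)AB = Σ_{i+j=n} ((a_i − A) b_j + A (b_j − B))`
    have hdec : (∑ p ∈ antidiagonal n, a p.1 * b p.2) - (n + 1) * (A * B) =
        ∑ p ∈ antidiagonal n, ((a p.1 - A) * b p.2 + A * (b p.2 - B)) := by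
      rw [Finset.sum_add_distrib]
      have hcard : ((antidiagonal n).card : ℝ) = n + 1 := by rw [Finset.Nat.card_antidiagonal]; push_cast; ring
      have : (n + 1) * (A * B) = ∑ _p ∈ antidiagonal n, A * B := by rw [sum_const, nsmul_eq_mul, hcard]
      rw [this, ← Finset.sum_sub_distrib, ← Finset.sum_add_distrib]
      exact sum_congr rfl fun p _ => by ring
    have hlhs : (∑ p ∈ antidiagonal n, a p.1 * b p.2) / (n + 1) - A * B =
        ((∑ p ∈ antidiagonal n, a p.1 * b p.2) - (n + 1) * (A * B)) / (n + 1) := by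
      field_simp
    rw [hlhs, hdec, abs_div, abs_of_pos hn, div_le_iff₀ hn]
    have hcast : (((n + 1 : ℕ) : ℝ)⁻¹) = 1 / (n + 1) := by push_cast; rw [one_div]
    rw [hcast]
    calc |∑ p ∈ antidiagonal n, ((a p.1 - A) * b p.2 + A * (b p.2 - B))|
        ≤ ∑ p ∈ antidiagonal n, (M * |a p.1 - A| + |A| * |b p.2 - B|) := by
          refine (abs_sum_le_sum_abs _ _).trans (sum_le_sum fun p _ => ?_)
          calc |(a p.1 - A) * b p.2 + A * (b p.2 - B)| ≤ |(a p.1 - A) * b p.2| + |A * (b p.2 - B)| := abs_add_le _ _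
            _ = |a p.1 - A| * |b p.2| + |A| * |b p.2 - B| := by rw [abs_mul, abs_mul]
            _ ≤ |a p.1 - A| * M + |A| * |b p.2 - B| := by
                have := mul_le_mul_of_nonneg_left (hbabs p.2) (abs_nonneg (a p.1 - A)); linarith
            _ = M * |a p.1 - A| + |A| * |b p.2 - B| := by ring
      _ = M * ∑ i ∈ range (n + 1), |a i - A| + |A| * ∑ i ∈ range (n + 1), |b i - B| := by
          rw [sum_add_distrib, ← mul_sum, ← mul_sum]
          congr 1
          · rw [Finset.Nat.sum_antidiagonal_eq_sum_range_succ_mk]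
          · congr 1
            rw [← Finset.Nat.sum_antidiagonal_swap, Finset.Nat.sum_antidiagonal_eq_sum_range_succ_mk]
            simp
      _ = (M * (1 / (↑n + 1) * ∑ i ∈ range (n + 1), |a i - A|) + |A| * (1 / (↑n + 1) * ∑ i ∈ range (n + 1), |b i - B|)) * (↑n + 1) := by
          field_simp
  have hlim : Tendsto (fun n : ℕ => M * ((((n + 1 : ℕ) : ℝ)⁻¹) * ∑ i ∈ range (n + 1), |a i - A|) +
      |A| * ((((n + 1 : ℕ) : ℝ)⁻¹) * ∑ i ∈ range (n + 1), |b i - B|)) atTop (𝓝 (M * 0 + |A| * 0)) :=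
    (hca'.const_mul M).add (hcb'.const_mul |A|)
  rw [mul_zero, mul_zero, add_zero] at hlim
  rw [Metric.tendsto_atTop]
  intro ε hε
  obtain ⟨N, hN⟩ := Metric.tendsto_atTop.1 hlim ε hε
  refine ⟨N, fun n hn => ?_⟩
  rw [Real.dist_eq]
  have h1 := hN n hn
  rw [Real.dist_eq, sub_zero] at h1
  exact lt_of_le_of_lt ((hbound n).trans (le_abs_self _)) h1

end Pointwise

section PointwiseMain

variable (W : RewardPair K)

/-- The derived renewal equation as a power-series identity over the matrix ring: `S = R·G + I·S` (`G = 1 + D`). [cite: Feller1968, XIII.11; lane plumbing a-p2 g23] -/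
theorem serS_eq : PowerSeries.mk W.S = PowerSeries.mk W.R * K.serG + K.serM * PowerSeries.mk W.S := by
  refine PowerSeries.ext fun m => ?_
  rw [map_add, coeff_mk, PowerSeries.coeff_mul, PowerSeries.coeff_mul, W.ren m]
  have hG : ∀ j, coeff j K.serG = (if j = 0 then (1 : Matrix ι ι ℝ) else 0) + K.D j := fun j => by
    rw [RenewalKernelPair.serG, map_add, PowerSeries.coeff_one, coeff_mk]
  simp only [coeff_mk, hG, coeff_serM, mul_add, sum_add_distrib]
  have h1 : ∑ p ∈ antidiagonal m, W.R p.1 * (if p.2 = 0 then (1 : Matrix ι ι ℝ) else 0) = W.R m := by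
    rw [Finset.sum_eq_single (m, 0)]
    · simp
    · intro p hp hne
      have hp' := HasAntidiagonal.mem_antidiagonal.mp hp
      have : p.2 ≠ 0 := fun h0 => hne (by ext <;> simp <;> omega)
      simp [this]
    · intro h; exact absurd (HasAntidiagonal.mem_antidiagonal.mpr (by simp)) h
  rw [h1, add_assoc]

/-- ★★ **The coefficient sandwich `S = G · R · G`** as power series (`G = 1 + D = Σ_k I^k`): from `(1 − I)S = RG` and the RIGHT-sided identity
`G(1 − I) = 1` (`ren_right`). [cite: Feller1968, XIII.11; Seneta1973, §6.1; lane «pcv-sawmu» a-p2 g23 — own] -/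
theorem serS_eq_sandwich : PowerSeries.mk W.S = K.serG * PowerSeries.mk W.R * K.serG := by
  -- `G = 1 + G·I` as power series (the right renewal equation)
  have hright : K.serG = 1 + K.serG * K.serM := by
    refine PowerSeries.ext fun m => ?_
    rw [map_add, PowerSeries.coeff_mul, PowerSeries.coeff_one]
    have hG : ∀ j, coeff j K.serG = (if j = 0 then (1 : Matrix ι ι ℝ) else 0) + K.D j := fun j => by
      rw [RenewalKernelPair.serG, map_add, PowerSeries.coeff_one, coeff_mk]
    simp only [hG, coeff_serM, add_mul, sum_add_distrib]
    have h1 : ∑ p ∈ antidiagonal m, (if p.1 = 0 then (1 : Matrix ι ι ℝ) else 0) * K.M p.2 = K.M m := by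
      rw [Finset.sum_eq_single (0, m)]
      · simp
      · intro p hp hne
        have hp' := HasAntidiagonal.mem_antidiagonal.mp hp
        have : p.1 ≠ 0 := fun h0 => hne (by ext <;> simp <;> omega)
        simp [this]
      · intro h; exact absurd (HasAntidiagonal.mem_antidiagonal.mpr (by simp)) h
    rw [h1, K.ren_right m]
  have hinv : K.serG * (1 - K.serM) = 1 := by
    rw [mul_sub, mul_one, sub_eq_iff_eq_add', add_comm]
    exact hright
  have h1 : (1 - K.serM) * PowerSeries.mk W.S = PowerSeries.mk W.R * K.serG := by
    rw [sub_mul, one_mul, sub_eq_iff_eq_add]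
    exact W.serS_eq
  calc PowerSeries.mk W.S = (K.serG * (1 - K.serM)) * PowerSeries.mk W.S := by rw [hinv, one_mul]
    _ = K.serG * ((1 - K.serM) * PowerSeries.mk W.S) := by rw [mul_assoc]
    _ = K.serG * (PowerSeries.mk W.R * K.serG) := by rw [h1]
    _ = K.serG * PowerSeries.mk W.R * K.serG := by rw [mul_assoc]

/-- The coefficient form of the sandwich: `S(m)_{ab} = Σ_{i+n=m} Σ_d (Σ_{k+j=i} Σ_c G(k)_{ac} R(j)_{cd}) G(n)_{db}` (plumbing). [cite: Feller1968, XIII.11; lane plumbing a-p2 g23] -/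
theorem S_eq_conv (m : ℕ) (a b : ι) :
    W.S m a b = ∑ p ∈ antidiagonal m, ∑ d, (∑ q ∈ antidiagonal p.1, ∑ c, K.G q.1 a c * W.R q.2 c d) * K.G p.2 d b := by
  have h := congr_arg (fun F => cf m F a b) W.serS_eq_sandwich
  simp only [cf_mk] at h
  rw [h, cf_mul]
  refine sum_congr rfl fun p _ => sum_congr rfl fun d _ => ?_
  rw [cf_mul]
  simp only [cf_mk]
  rfl

/-- `G(m)_{ab} → L_{ab}` (the tree's `tendsto_coeff`, with `G(m) = D(m)` for `m ≥ 1`). [cite: Feller1968, XIII.3; lane plumbing a-p2 g23] -/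
theorem tendsto_G_of_critical (h : K.Critical L) (a b : ι) : Tendsto (fun m => K.G m a b) atTop (𝓝 (L a b)) := by
  refine (K.tendsto_coeff h a b).congr' ?_
  filter_upwards [eventually_ge_atTop 1] with m hm
  exact (K.G_eq_D (by omega) a b).symm

/-- ★★★ **POINTWISE RENEWAL–REWARD: `S(m)_{ab}/(m+1) → (L R̄ L)_{ab}`** under `K.Critical L` (aperiodic case built into `Critical`): the total reward
of all sequences of total length `m` grows LINEARLY with the explicit rank-one slope `L R̄ L` — «convergent ∗ summable → limit × sum» (tree,
`Renewal.tendsto_sum_antidiagonal_mul`) for `G ∗ R`, then a Cesàro product for `(G ∗ R) ∗ G`. [cite: Feller1968, XIII.11 (renewal–reward theorem); MadrasSlade1993, Appendix B (convolution limits); Cinlar1969MarkovRenewal, Markov renewal theory (locator carried — not held); lane «pcv-sawmu» a-p2 g23 — own arrangement] -/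
theorem tendsto_S_div (h : K.Critical L) (a b : ι) :
    Tendsto (fun m : ℕ => W.S m a b / (m + 1)) atTop (𝓝 (∑ d, (∑ c, L a c * ∑' j : ℕ, W.R j c d) * L d b)) := by
  -- inner convolution `H(i)_{ad} = Σ_{k+j=i} Σ_c G(k)_{ac} R(j)_{cd} → Σ_c L_{ac} R̄_{cd}`
  have hH : ∀ d, Tendsto (fun i : ℕ => ∑ q ∈ antidiagonal i, ∑ c, K.G q.1 a c * W.R q.2 c d) atTop
      (𝓝 (∑ c, L a c * ∑' j : ℕ, W.R j c d)) := fun d => by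
    have hswap : ∀ i : ℕ, ∑ c, ∑ q ∈ antidiagonal i, W.R q.1 c d * K.G q.2 a c =
        ∑ q ∈ antidiagonal i, ∑ c, K.G q.1 a c * W.R q.2 c d := fun i => by
      rw [sum_comm, ← Finset.Nat.sum_antidiagonal_swap]
      exact sum_congr rfl fun q _ => sum_congr rfl fun c _ => by simp only [Prod.fst_swap, Prod.snd_swap]; ring
    have hlim : Tendsto (fun i : ℕ => ∑ c, ∑ q ∈ antidiagonal i, W.R q.1 c d * K.G q.2 a c) atTop
        (𝓝 (∑ c, L a c * ∑' j : ℕ, W.R j c d)) := by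
      refine tendsto_finsetSum _ fun c _ => ?_
      have hG := tendsto_G_of_critical h a c
      obtain ⟨B, hB⟩ := hG.bddAbove_range
      have hGB : ∀ n, |K.G n a c| ≤ B := fun n => by rw [abs_of_nonneg (K.G_nonneg n a c)]; exact hB ⟨n, rfl⟩
      have hval : L a c * ∑' j : ℕ, W.R j c d = (∑' j : ℕ, W.R j c d) * L a c := mul_comm _ _
      rw [hval]
      exact Renewal.tendsto_sum_antidiagonal_mul (g := fun j => W.R j c d) (u := fun n => K.G n a c)
        (fun j => W.R_nonneg j c d) (W.summable_R c d) hGB hG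
    exact hlim.congr fun i => hswap i
  -- outer Cesàro product, level by level
  have hsum : Tendsto (fun m : ℕ => ∑ d, (∑ p ∈ antidiagonal m,
      (∑ q ∈ antidiagonal p.1, ∑ c, K.G q.1 a c * W.R q.2 c d) * K.G p.2 d b) / ((m : ℝ) + 1)) atTop
      (𝓝 (∑ d, (∑ c, L a c * ∑' j : ℕ, W.R j c d) * L d b)) :=
    tendsto_finsetSum _ fun d _ =>
      tendsto_antidiagonal_mul_div (a := fun i : ℕ => ∑ q ∈ antidiagonal i, ∑ c, K.G q.1 a c * W.R q.2 c d)
        (b := fun n : ℕ => K.G n d b) (hH d) (tendsto_G_of_critical h d b)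
  refine hsum.congr fun m => ?_
  have hS := W.S_eq_conv m a b
  rw [hS, Finset.sum_div]
  simp only [Finset.sum_div]
  exact Finset.sum_comm

/-- ★★★★ **THE RENEWAL–REWARD THEOREM, POINTWISE FORM**: under `K.Critical L`, for every reference level `o` and ALL levels `a, b`,
`S(m)_{ab} / ((m+1) · D(m)_{ab}) ⟶ (Σ_{c,d} L_{oc} R̄_{cd} L_{do}) / L_{oo}`
— the mean reward PER UNIT LENGTH of the sequences of pieces `a → b` of total length `m` converges, to a limit independent of `a, b`: (mean reward)/(mean length)
of ONE piece under the invariant weighting.  The pointwise upgrade of `tendsto_reward_per_length`. [cite: Feller1968, XIII.11; Cinlar1969MarkovRenewal, Markov renewal theory (locator carried — not held); Seneta1973, §6.2; lane «pcv-sawmu» a-p2 g23 — own arrangement] -/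
theorem tendsto_S_div_D (h : K.Critical L) (o a b : ι) :
    Tendsto (fun m : ℕ => W.S m a b / ((m + 1) * K.D m a b)) atTop
      (𝓝 ((∑ d, (∑ c, L o c * ∑' j : ℕ, W.R j c d) * L d o) / L o o)) := by
  have h1 := W.tendsto_S_div h a b
  have h2 := K.tendsto_coeff h a b
  have hq := h1.div h2 (h.pos a b).ne'
  have hval : (∑ d, (∑ c, L a c * ∑' j : ℕ, W.R j c d) * L d b) / L a b =
      (∑ d, (∑ c, L o c * ∑' j : ℕ, W.R j c d) * L d o) / L o o := by
    rw [div_eq_div_iff (h.pos a b).ne' (h.pos o o).ne', sum_mul, sum_mul]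
    refine sum_congr rfl fun d _ => ?_
    rw [sum_mul, sum_mul, sum_mul, sum_mul]
    refine sum_congr rfl fun c _ => ?_
    have h3 : L a c * L d b * L o o = L o c * L d o * L a b := by
      have e1 := h.L_mul_L_eq a c o o
      have e2 := h.L_mul_L_eq d b a o
      calc L a c * L d b * L o o = (L a c * L o o) * L d b := by ring
        _ = L a o * L o c * L d b := by rw [e1]
        _ = L o c * (L d b * L a o) := by ring
        _ = L o c * (L d o * L a b) := by rw [e2]
        _ = L o c * L d o * L a b := by ring
    calc L a c * (∑' j : ℕ, W.R j c d) * L d b * L o o = (∑' j : ℕ, W.R j c d) * (L a c * L d b * L o o) := by ring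
      _ = (∑' j : ℕ, W.R j c d) * (L o c * L d o * L a b) := by rw [h3]
      _ = L o c * (∑' j : ℕ, W.R j c d) * L d o * L a b := by ring
  rw [← hval]
  refine hq.congr fun m => ?_
  rw [Pi.div_apply, div_div]

end PointwiseMain

end RewardPair

/-! ### §6 The elementary renewal theorem for the number of pieces: `N(m)_{ab}/((m+1) D(m)_{ab}) → ⟨ℓ, u⟩/⟨ℓ, μ u⟩` -/

section Pieces

variable (K)

/-- The piece-count kernel `N := G · I · G = Σ_k k I^k` as a power series: the coefficient `N(m)_{ab}` is the total weight of the sequences of pieces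
`a → b` of total length `m`, each counted with multiplicity = its number of pieces (bookkeeping: `Σ_{k ≥ 1} k·I^k = G I G` since `G = Σ_k I^k` commutes with `I`).
We only use the sandwich form. [cite: Feller1968, XIII.3, XIII.11; lane plumbing a-p2 g23] -/
theorem cf_serG_mul_serM_mul_serG_nonneg (m : ℕ) (a b : ι) : 0 ≤ cf m (K.serG * K.serM * K.serG) a b := by
  rw [cf_mul]
  refine sum_nonneg fun p _ => sum_nonneg fun d _ => mul_nonneg ?_ (K.G_nonneg _ _ _)
  rw [cf_mul]
  exact sum_nonneg fun q _ => sum_nonneg fun c _ => mul_nonneg (K.G_nonneg _ _ _) (by rw [cf_serM]; exact K.M_nonneg _ _ _)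

variable {K}

/-- ★★ **The piece-count pair is a reward pair with one-piece reward `R = I`**: `N = I + I·D + I·N` coefficientwise (`GIG = I·G + I·(GIG)` from `G = 1 + IG`),
`Σ_j I(j) < ∞` and `Σ_m N(m)s^m < ∞` on `[0,1)` under `K.Critical L`. [cite: Feller1968, XIII.11 (cumulative processes: the number of renewals); lane «pcv-sawmu» a-p2 g23 — own arrangement] -/
def Critical.piecesRewardPair (h : K.Critical L) : RewardPair K where
  R := K.M
  S := fun m => coeff m (K.serG * K.serM * K.serG)
  R_nonneg := K.M_nonneg
  S_nonneg := fun m a b => K.cf_serG_mul_serM_mul_serG_nonneg m a b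
  ren := fun m => by
    -- power-series identity `G I G = I G + I (G I G)` (from `G = 1 + I G`) and `I G = I + I D`, read off coefficientwise
    have hG : K.serG = 1 + K.serM * K.serG := K.serG_eq
    have h1 : K.serG * K.serM * K.serG = K.serM * K.serG + K.serM * (K.serG * K.serM * K.serG) := by
      calc K.serG * K.serM * K.serG = (1 + K.serM * K.serG) * K.serM * K.serG := by rw [← hG]
        _ = K.serM * K.serG + K.serM * (K.serG * K.serM * K.serG) := by noncomm_ring
    have h2 : K.serM * K.serG = K.serM + K.serM * PowerSeries.mk K.D := by
      rw [RenewalKernelPair.serG, mul_add, mul_one]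
    rw [h2] at h1
    have hc := congr_arg (coeff m) h1
    rw [map_add, map_add, coeff_serM] at hc
    rw [hc, PowerSeries.coeff_mul, PowerSeries.coeff_mul, add_assoc, ← sum_add_distrib]
    simp only [coeff_serM, coeff_mk]
  summable_R := h.summable_M
  summable_S := fun a b s hs0 hs1 => by
    -- `N(m)_{ab} s^m = Σ_{p} Σ_d [cf p.1 (G I)]_{ad} s^{p.1} · G(p.2)_{db} s^{p.2}`: Cauchy products of summable non-negative series
    have hGs : ∀ c d, Summable fun m : ℕ => K.G m c d * s ^ m := fun c d => by
      have hD := h.summable c d s hs0 hs1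
      have : (fun m : ℕ => K.G m c d * s ^ m) = fun m => (if m = 0 ∧ c = d then (1 : ℝ) else 0) * s ^ m + K.D m c d * s ^ m := by
        funext m
        rw [K.G_apply]
        ring
      rw [this]
      refine Summable.add ?_ hD
      exact summable_of_ne_finset_zero (s := {0}) fun m hm => by
        rw [Finset.mem_singleton] at hm
        rw [if_neg (fun h' => hm h'.1), zero_mul]
    have hMs : ∀ c d, Summable fun m : ℕ => K.M m c d * s ^ m := fun c d => h.summable_genM c d hs0 hs1.le
    -- inner: `H(i)_{ad} := cf i (G I) a d`, summable with powers
    have hH : ∀ d, Summable fun i : ℕ => cf i (K.serG * K.serM) a d * s ^ i := fun d => by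
      have : (fun i : ℕ => cf i (K.serG * K.serM) a d * s ^ i) =
          fun i => ∑ c, (∑ q ∈ antidiagonal i, K.G q.1 a c * K.M q.2 c d) * s ^ i := by
        funext i
        rw [cf_mul, sum_comm, sum_mul]
        refine sum_congr rfl fun c _ => ?_
        simp only [cf_serM]
        rfl
      rw [this]
      refine summable_sum fun c _ => ?_
      exact (tsum_antidiagonal_mul_pow₄ (fun m => K.G_nonneg m a c) (fun m => K.M_nonneg m c d) hs0 (hGs a c) (hMs c d)).1
    have hH0 : ∀ i d, 0 ≤ cf i (K.serG * K.serM) a d := fun i d => by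
      rw [cf_mul]
      exact sum_nonneg fun q _ => sum_nonneg fun c _ => mul_nonneg (K.G_nonneg _ _ _) (by rw [cf_serM]; exact K.M_nonneg _ _ _)
    have : (fun m : ℕ => cf m (K.serG * K.serM * K.serG) a b * s ^ m) =
        fun m => ∑ d, (∑ p ∈ antidiagonal m, cf p.1 (K.serG * K.serM) a d * K.G p.2 d b) * s ^ m := by
      funext m
      rw [cf_mul, sum_comm, sum_mul]
      exact sum_congr rfl fun d _ => rfl
    show Summable fun m : ℕ => cf m (K.serG * K.serM * K.serG) a b * s ^ m
    rw [this]
    refine summable_sum fun d _ => ?_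
    exact (tsum_antidiagonal_mul_pow₄ (hH0 · d) (fun m => K.G_nonneg m d b) hs0 (hH d) (hGs d b)).1

/-- ★★★ **THE ELEMENTARY RENEWAL THEOREM FOR THE NUMBER OF PIECES** (matrix form, pointwise): under `K.Critical L`, for every reference level `o` and
ALL levels `a, b`, the mean number of pieces PER UNIT LENGTH of the sequences `a → b` of total length `m` converges:
`N(m)_{ab}/((m+1) · D(m)_{ab}) ⟶ (Σ_c L_{oc} L_{co}) / L_{oo}`  (`= ⟨ℓ, u⟩/⟨ℓ, μ u⟩` for any fixed vectors `u`, `ℓ` of `M̂`, since `L_{ab}⟨ℓ, μu⟩ = u_aℓ_b`: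
the reciprocal of the mean piece length under the invariant weighting) — from the pointwise renewal–reward theorem with reward `R = I` and `M̂L = L`.
[cite: Feller1968, XIII.3 (elementary renewal theorem), XIII.11; Cinlar1969MarkovRenewal, Markov renewal theory (locator carried — not held); lane «pcv-sawmu» a-p2 g23 — own arrangement] -/
theorem Critical.tendsto_pieces_div_D (h : K.Critical L) (o a b : ι) :
    Tendsto (fun m : ℕ => cf m (K.serG * K.serM * K.serG) a b / ((m + 1) * K.D m a b)) atTop
      (𝓝 ((∑ c, L o c * L c o) / L o o)) := by
  have hmain := (h.piecesRewardPair).tendsto_S_div_D h o a b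
  have hval : (∑ d, (∑ c, L o c * ∑' j : ℕ, (h.piecesRewardPair).R j c d) * L d o) = ∑ c, L o c * L c o := by
    refine sum_congr rfl fun d _ => ?_
    have : ∑ c, L o c * ∑' j : ℕ, (h.piecesRewardPair).R j c d = L o d := by
      show ∑ c, L o c * ∑' j : ℕ, K.M j c d = L o d
      exact h.L_mul_tsum_M o d
    rw [this]
  rw [hval] at hmain
  exact hmain

end Pieces

end RenewalKernelPair

end Literature.Probability.Process
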